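import Summits.QuantumFields.BalabanUV.T4Continuum.Support.NE3QuadRemainderGaugedProfile
import Summits.QuantumFields.BalabanUV.T4Continuum.Support.NE3QuadRemainderGaugedEnd
import Summits.QuantumFields.BalabanUV.T4Continuum.Support.NE3CpushGaugeCovariance
import Summits.QuantumFields.BalabanUV.T4Continuum.Support.NE3EnergyChartLeavesSockets
import Summits.QuantumFields.BalabanUV.T4Continuum.Support.NE3CovariantBlockPoincare
import Summits.QuantumFields.BalabanUV.T4Continuum.Support.NE3ResidualSliceRep
import HarnessLib

/-!
# NE7GaugedTwoTierFar — THE LEAF (Π-REG-γ″) READ AT THE FAR CONFIGURATION: the gauged two-tier data `(λ, B)` of the relative field `X₀` at `W` FLIP to gauged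
# two-tier data `(−λ, −Ad_{e^{λ}}B)` of `−X₀` at `W·e^{X₀}` with the SAME tiers `(m, ℓ, Λ)`, the same profile and the same corner sets — so F235's far-end local
# quadratic letter is row NE3's Π-C-3γ″ supplier read once more, and «hleaves²» costs the leaf nothing

Cell `pub-balaban`, rung (B)+1 sub-cell t4, lineage `b2b-balaban-t4-ne7-p1` (CRUX PROVER NE7 #1 = OWNER of row NE7), generation 87; memo
`t4/b2b-balaban-t4-ne7-p1-g87/ROAD-B-IS-UNIQUENESS.md` §3(d)(iii).  File F237 (over row NE3 leaf-02's `NE3GaugedTwoTierShape` and the kernel identities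
`NE3CpushGaugeCovariance.vary_gaugeAct`, `NE3EnergyChartLeavesSockets.vary_vary_neg_one`, `NE3SmoothLiftW.gaugeAct_inv_gaugeAct`, `NE3CovariantBlockPoincare.Ad_inv_Ad`).

WHY.  F235 `NE7CriticalPairOfRoutePi` closes road (B)'s END (the curved (APE) at a tangent-critical reference = uniqueness of the critical orbit) modulo F31's per-pair
binder `hleaves` PLUS one far-end copy of its local quadratic letter `‖dirIter L (k+1) (U′^u) X₀ (z,κ)‖ ≤ C₂(M·m(z,κ))²`.  In row NE3's hands that letter is the output
of Π-C-3γ″ (`NE3QuadRemainderGaugedProfile.norm_dirIter_le_combined_of_gaugedTwoTier_profile`) from the leaf (Π-REG-γ″) `GaugedTwoTier L N k W X₀ prof S m ℓ Λ C`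
and the fibre.  At the far configuration `U♭ = W·e^{X₀}` the direction `−X₀` has the same top (`U♭·e^{−X₀} = W`) and — THIS FILE — the SAME leaf data up to the
gauge flip `λ ↦ −λ`, `B ↦ −Ad_{e^{λ(·+e_μ)}}B` (isometric, skew-preserving): `(W·e^{X₀})·e^{−X₀} = W = ((W·e^{X₀})·e^{−Ad B})^{e^{−λ}}` by
`W·e^{X₀} = (W·e^{B})^{e^{λ}}`.  Hence `GaugedTwoTier L N k (W·e^{X₀}) (−X₀) prof S m ℓ Λ C` (square-summability is even in `X₀`), and Π-C-3γ″ applies verbatim at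
`U♭` (its background hypotheses are class data, which `U♭` has).
WHAT ([folklore]; 0 def, 0 sorry).
§1 `vary_neg_one_eq`, `expGauge_neg`, `vary_vary_neg` — the three identities (`V·e^{(−1)ψ} = V·e^{−ψ}`, `e^{−λ} = (e^{λ})⁻¹` sitewise, `(W·e^{X})·e^{−X} = W`).
§2 **`gaugedTwoTierData_far`** — `GaugedTwoTierData L N k W X₀ prof S λ B m ℓ Λ ⟹ GaugedTwoTierData L N k (vary W X₀ 1) (−X₀) prof S (−λ) (−Ad_{e^{λ(·+e_μ)}}B) m ℓ Λ`.
§3 **`gaugedTwoTier_far`** — `GaugedTwoTier L N k W X₀ prof S m ℓ Λ C ⟹ GaugedTwoTier L N k (vary W X₀ 1) (−X₀) prof S m ℓ Λ C`.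
§4 **`norm_dirIter_far_le_of_gaugedTwoTier_profile`** — THE FAR LETTER FROM THE BASE LEAF: Π-C-3γ″ read at `U♭ = W·e^{X₀}` with the flipped data:
   `‖dirIter L (j+1) (W·e^{X₀}) X₀ (z,κ)‖ ≤ C^γ(d,L)·(L^{j+1}·√(m² + ℓ² + (Λ∕L^{j+1})²)(z,κ))²` — F235's `hφq'` with the SAME combined weight as the base letter.
HONEST FRAMING (page 1): pure gauge algebra on the leaf SHAPE; the leaf itself is asserted for NO pair (row NE3's hypothesis of record); nothing of Bałaban's asserted;
NOT (APE), NOT ONE-STEP, NOT NE7; spine 0∕9; finite T⁴ rung (B)+1 — NOT infinite volume, NOT mass gap, NOT `BetaPertH`, NOT Clay.  Continuum YM on T⁴ ⇐ BetaPertH ∧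
nine spine estimates (0/9 proved); BetaPertH ⇐ (D1) ∧ (D4) ∧ CAP+tail; G-an2-4 gates asym, D1 and NE2/3/4.
-/

set_option autoImplicit false

open scoped BigOperators Matrix.Norms.L2Operator
open NormedSpace Finset

namespace Summit.QuantumFields.BalabanUV.T4Continuum.NE7GaugedTwoTierFar

open Literature.MathematicalPhysics.QuantumFieldTheory.Balaban1983to89
open B7Prop1Explicit B7Prop2Explicit MatrixLog
open B7Prop1Local (InBox loK bondHiK)
open T4AveragingDeficitWall (IsSkewDir vary dirSq Ad)
open T4AveragingDeficitWallBoundary (periodBox)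
open AveragingDeficitPeriodicCounting (IsPeriodicDir)
open AveragingDeficitTransport (Ad_mem_skewAdjoint norm_Ad_of_unitary)
open BlockAveragePushDirGauge (gaugeDir expGauge)
open NE3QuadRemainderGaugeStep (expGauge_one_mem_unitaryUnits)
open NE3SmoothLiftW (gaugeAct_inv_gaugeAct)
open NE3GaugedTwoTierShape (GaugedTwoTierData GaugedTwoTier)
open NE3CpushGaugeCovariance (vary_gaugeAct)
open NE3EnergyChartLeavesSockets (vary_vary_neg_one)
open NE3CovariantBlockPoincare (Ad_inv_Ad)
open T4AveragingDeficitWall (IsUnitaryCfg SmallField)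
open T4AveragingDeficitWallBoundary (IsPeriodicCfg)
open AveragingDeficitMultiLevelPrep (cavgIter LevelSmall)
open BlockAverageVaryDisc (rho0)
open NE3TangentCovariantTower (dirIter)
open NE3LinearisedAverageSup (curvSum)
open NE3CovariantLineSumsError (Ssum)
open NE3MajorantProfileTower (cK)
open NE3LinearTowerProfile (profd Aσ Bβ)
open NE3QuadRemainderGaugedProfile (norm_dirIter_le_combined_of_gaugedTwoTier_profile)
open NE3ResidualSliceRep (dirIter_sub)

noncomputable section

variable {d : ℕ} {n : Type*} [Fintype n] [DecidableEq n]

/-! ## §1 Three identities -/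

/-- `V·e^{(−1)·ψ} = V·e^{1·(−ψ)}`. [folklore] -/
theorem vary_neg_one_eq (V : Site d → Fin d → (Matrix n n ℂ)ˣ) (ψ : Site d → Fin d → Matrix n n ℂ) :
    vary V ψ (-1) = vary V (fun x μ => -ψ x μ) 1 := by
  funext x μ
  simp only [vary, Complex.ofReal_neg, Complex.ofReal_one, neg_smul, one_smul, smul_neg]

/-- `e^{−λ} = (e^{λ})⁻¹` sitewise: `expGauge (−λ) 1 = (expGauge λ 1)⁻¹`. [folklore] -/
theorem expGauge_neg (lam : Site d → Matrix n n ℂ) :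
    (expGauge (fun y => -lam y) 1) = fun z => (expGauge lam 1 z)⁻¹ := by
  funext z
  simp only [expGauge, Complex.ofReal_one, one_smul]
  apply Units.ext
  rw [val_inv_expUnit]

/-- `(W·e^{X})·e^{−X} = W`. [folklore] -/
theorem vary_vary_neg (W : Site d → Fin d → (Matrix n n ℂ)ˣ) (X : Site d → Fin d → Matrix n n ℂ) :
    vary (vary W X 1) (fun x μ => -X x μ) 1 = W := by
  rw [← vary_neg_one_eq]; exact vary_vary_neg_one W X

/-! ## §2 The gauge data flip to the far configuration -/

/-- **THE FAR GAUGE DATA**: from `GaugedTwoTierData L N k W X₀ prof S λ B m ℓ Λ` (in particular `W·e^{X₀} = (W·e^{B})^{e^{λ}}`), the pair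
`(λ′, B′) := (−λ, −Ad_{e^{λ(x+e_μ)}} B(x,μ))` satisfies `GaugedTwoTierData L N k (W·e^{X₀}) (−X₀) prof S λ′ B′ m ℓ Λ`: the relation
`(W·e^{X₀})·e^{−X₀} = ((W·e^{X₀})·e^{B′})^{e^{λ′}}`, skewness∕periodicity∕smallness of the flipped data, and the SAME box dominations (`Ad` by a unitary is an
isometry). [folklore] -/
theorem gaugedTwoTierData_far [Nonempty n] {L N k : ℕ} {W : Site d → Fin d → (Matrix n n ℂ)ˣ} {X₀ : Site d → Fin d → Matrix n n ℂ} {prof : Site d → ℝ}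
    {S : Site d → Fin d → Finset (Site d)} {lam : Site d → Matrix n n ℂ} {B : Site d → Fin d → Matrix n n ℂ} {m ℓ Λ : Site d → Fin d → ℝ}
    (h : GaugedTwoTierData L N k W X₀ prof S lam B m ℓ Λ) :
    GaugedTwoTierData L N k (vary W X₀ 1) (fun x μ => -X₀ x μ) prof S (fun y => -lam y)
      (fun x μ => -Ad (expGauge lam 1 (x + e μ)) (B x μ)) m ℓ Λ := by
  have hu : ∀ y, expGauge lam 1 y ∈ unitaryUnits (Matrix n n ℂ) := expGauge_one_mem_unitaryUnits h.lam_skew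
  -- periodicity of the gauge
  have hgP : ∀ (y : Site d) (i : Fin d), expGauge lam 1 (y + ((L ^ k * N : ℕ) : ℤ) • e i) = expGauge lam 1 y := by
    intro y i; simp only [expGauge, h.lam_per y i]
  -- norm of the flipped companion
  have hnB : ∀ x μ, ‖-Ad (expGauge lam 1 (x + e μ)) (B x μ)‖ = ‖B x μ‖ := fun x μ => by
    rw [norm_neg, norm_Ad_of_unitary (hu _)]
  refine ⟨fun y => (skewAdjoint (Matrix n n ℂ)).neg_mem (h.lam_skew y), fun y i => by rw [h.lam_per y i], fun y => ?_, fun x μ => ?_, fun x i μ => ?_,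
    fun x μ => ?_, ?_, fun z κ y μ hy hy' => ?_, fun z κ y hy => ?_⟩
  · rw [norm_neg]; exact h.lam_small y
  · exact (skewAdjoint (Matrix n n ℂ)).neg_mem (Ad_mem_skewAdjoint (hu _) (h.B_skew x μ))
  · show -Ad (expGauge lam 1 (x + ((L ^ k * N : ℕ) : ℤ) • e i + e μ)) (B (x + ((L ^ k * N : ℕ) : ℤ) • e i) μ) = -Ad (expGauge lam 1 (x + e μ)) (B x μ)
    rw [h.B_per x i μ, add_right_comm, hgP]
  · rw [hnB]; exact h.B_small x μ
  · -- the gauge relation at the far configuration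
    have hE := h.gauge_eq
    -- `W·e^{B} = (W·e^{X₀})^{e^{−λ}}`
    have h1 : vary W B 1 = gaugeAct (fun z => (expGauge lam 1 z)⁻¹) (vary W X₀ 1) := by
      rw [hE, gaugeAct_inv_gaugeAct]
    -- `W = (W·e^{B})·e^{−B} = ((W·e^{X₀})^{e^{−λ}})·e^{−B} = ((W·e^{X₀})·e^{−Ad B})^{e^{−λ}}`
    have h2 : vary (gaugeAct (fun z => (expGauge lam 1 z)⁻¹) (vary W X₀ 1))
        (fun x μ => Ad ((fun z => (expGauge lam 1 z)⁻¹) (x + e μ)) (-Ad (expGauge lam 1 (x + e μ)) (B x μ))) 1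
        = gaugeAct (fun z => (expGauge lam 1 z)⁻¹) (vary (vary W X₀ 1) (fun x μ => -Ad (expGauge lam 1 (x + e μ)) (B x μ)) 1) :=
      vary_gaugeAct _ _ _ 1
    have h3 : (fun x μ => Ad ((fun z => (expGauge lam 1 z)⁻¹) (x + e μ)) (-Ad (expGauge lam 1 (x + e μ)) (B x μ))) = fun x μ => -B x μ := by
      funext x μ
      show Ad (expGauge lam 1 (x + e μ))⁻¹ (-Ad (expGauge lam 1 (x + e μ)) (B x μ)) = -B x μ
      rw [AveragingDeficitNearIdentity.Ad_neg, Ad_inv_Ad]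
    rw [h3, ← h1, vary_vary_neg W B] at h2
    rw [vary_vary_neg W X₀, expGauge_neg]
    exact h2
  · rw [hnB]; exact h.dom_B z κ y μ hy hy'
  · rw [norm_neg]; exact h.dom_lam z κ y hy

/-! ## §3 The leaf at the far configuration -/

/-- **(Π-REG-γ″) AT THE FAR CONFIGURATION**: `GaugedTwoTier L N k W X₀ prof S m ℓ Λ C ⟹ GaugedTwoTier L N k (W·e^{X₀}) (−X₀) prof S m ℓ Λ C` — same tiers, same
profile, same corner sets, same constant (the square-summability clause is even in `X₀`).  Consequently row NE3's Π-C-3γ″ supplier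
(`NE3QuadRemainderGaugedProfile.norm_dirIter_le_combined_of_gaugedTwoTier_profile`) yields F235's far-end local quadratic letter at `U♭ = W·e^{X₀}` with the SAME
combined weight `√(m² + ℓ² + (Λ∕L^k)²)` from the SAME leaf, read at `U♭`. [folklore] -/
theorem gaugedTwoTier_far [Nonempty n] {L N k : ℕ} {W : Site d → Fin d → (Matrix n n ℂ)ˣ} {X₀ : Site d → Fin d → Matrix n n ℂ} {prof : Site d → ℝ}
    {S : Site d → Fin d → Finset (Site d)} {m ℓ Λ : Site d → Fin d → ℝ} {C : ℝ} (h : GaugedTwoTier L N k W X₀ prof S m ℓ Λ C) :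
    GaugedTwoTier L N k (vary W X₀ 1) (fun x μ => -X₀ x μ) prof S m ℓ Λ C := by
  obtain ⟨hm, hℓ, hΛ, hS, hC, ⟨lam, B, hD⟩, hsq⟩ := h
  refine ⟨hm, hℓ, hΛ, hS, hC, ⟨fun y => -lam y, fun x μ => -Ad (expGauge lam 1 (x + e μ)) (B x μ), gaugedTwoTierData_far hD⟩, ?_⟩
  have e : dirSq (fun x μ => -X₀ x μ) (periodBox (d := d) (N * L ^ k)) = dirSq X₀ (periodBox (d := d) (N * L ^ k)) := by
    unfold dirSq; simp only [norm_neg]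
  rw [e]; exact hsq

/-! ## §4 The far letter from the base leaf -/

/-- `dirIter` is odd in the direction in the multi-level small-field class: `‖dirIter L (j+1) U (−X) (z,κ)‖ = ‖dirIter L (j+1) U X (z,κ)‖`. [folklore] -/
theorem norm_dirIter_neg [Nonempty n] {L : ℕ} (hL : 1 ≤ L) (j : ℕ) {U : Site d → Fin d → (Matrix n n ℂ)ˣ} {x : ℝ} (hUu : IsUnitaryCfg U)
    (hx : 0 ≤ x) (hs : LevelSmall d L j x) (hUx : SmallField U x) (X : Site d → Fin d → Matrix n n ℂ) (z : Site d) (κ : Fin d) :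
    ‖dirIter L (j + 1) U (fun y μ => -X y μ) z κ‖ = ‖dirIter L (j + 1) U X z κ‖ := by
  have h0 : dirIter L (j + 1) U (fun _ _ => (0 : Matrix n n ℂ)) = fun _ _ => 0 := by
    have h := dirIter_sub hL j hUu hx hs hUx (fun _ _ => (0 : Matrix n n ℂ)) (fun _ _ => (0 : Matrix n n ℂ))
    simp only [sub_self] at h
    exact h
  have h := dirIter_sub hL j hUu hx hs hUx (fun _ _ => (0 : Matrix n n ℂ)) X
  have e : (fun y μ => (0 : Matrix n n ℂ) - X y μ) = fun y μ => -X y μ := by funext y μ; rw [zero_sub]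
  rw [e] at h
  have hz := congrFun (congrFun h z) κ
  rw [hz, congrFun (congrFun h0 z) κ, zero_sub, norm_neg]

/-- **THE FAR-END LOCAL QUADRATIC LETTER OF F235 FROM THE BASE LEAF (Π-REG-γ″), VIA §3 AND ROW NE3's Π-C-3γ″ SUPPLIER READ AT `U♭ = W·e^{X₀}`.**  Class data of
the far configuration `U♭` (unitary, `(L^{j+1}·N)`-periodic, `LevelSmall d L (j+1) x` and `LevelSmall d L j x`, `SmallField U♭ x`, the curvature-sum and `cK·Ssum`
lines — as in the supplier), of the base `W` as the endpoint (`x′`), the fibre `cavgIter (W·e^{X₀}) = cavgIter W`, the sup datum `s₀` of `X₀`, THE BASE LEAF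
`GaugedTwoTier L N (j+1) W X₀ (profd d) S m ℓ Λ C` and the ceiling `sm` of the companion tier ⟹
`‖dirIter L (j+1) (W·e^{X₀}) X₀ (z,κ)‖ ≤ C^γ(d,L)·(L^{j+1}·√(m² + ℓ² + (Λ∕L^{j+1})²)(z,κ))²` (`4 ≤ d`). [folklore] -/
theorem norm_dirIter_far_le_of_gaugedTwoTier_profile [Nonempty n] {L N j : ℕ} [NeZero N] (hd : 4 ≤ d) (hL : 2 ≤ L)
    {W : Site d → Fin d → (Matrix n n ℂ)ˣ} {X₀ : Site d → Fin d → Matrix n n ℂ} {x : ℝ}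
    (hUu : IsUnitaryCfg (vary W X₀ 1)) (hUP : IsPeriodicCfg (vary W X₀ 1) ((L ^ (j + 1) * N : ℕ) : ℤ)) (hx : 0 ≤ x)
    (hsm : LevelSmall d L (j + 1) x) (hsj : LevelSmall d L j x) (hUx : SmallField (vary W X₀ 1) x) (hA : curvSum d L (j + 1) x ≤ 2 / 3 * L)
    (hK : cK d L (d - 2) * Ssum d L (j + 1) x ≤ 1 / 2)
    (hX₀s : IsSkewDir X₀) (hX₀P : IsPeriodicDir X₀ ((L ^ (j + 1) * N : ℕ) : ℤ))
    {s₀ : ℝ} (hs₀ : 0 ≤ s₀) (hX₀ : ∀ (y : Site d) (μ : Fin d), ‖X₀ y μ‖ ≤ s₀) (hσ₀ : 4 * (3 + 12 * (d : ℝ)) ^ 2 * (L : ℝ) ^ (j + 1) * s₀ ≤ rho0 d L ^ 2)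
    (hfib : cavgIter L (j + 1) (vary W X₀ 1) = cavgIter L (j + 1) W)
    {x' : ℝ} (hx' : 0 ≤ x') (hsm' : LevelSmall d L j x') (hWx' : SmallField W x')
    {S : Site d → Fin d → Finset (Site d)} {m ℓ Λ : Site d → Fin d → ℝ} {C : ℝ}
    (hG : GaugedTwoTier L N (j + 1) W X₀ (profd d) S m ℓ Λ C)
    {sm : ℝ} (hms : ∀ (z : Site d) (κ : Fin d), m z κ ≤ sm)
    (hσsm : 4 * (3 + 12 * (d : ℝ)) ^ 2 * (L : ℝ) ^ (j + 1) * sm ≤ rho0 d L ^ 2) (hsm8 : 2 * (3 + 12 * (d : ℝ)) * (L : ℝ) ^ (j + 1) * sm ≤ 1 / 8192)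
    (z : Site d) (κ : Fin d) :
    ‖dirIter L (j + 1) (vary W X₀ 1) X₀ z κ‖
      ≤ (4 * (3 + 12 * (d : ℝ)) ^ 3 / rho0 d L ^ 2
            + 10240 * ((4 * (3 + 12 * (d : ℝ)) + 2) * (3 * 2 ^ d) ^ 2 + 2 * Aσ d + 3 * Bβ d L * ((d + 1) * (3 * 2 ^ d)) ^ 2))
          * ((L : ℝ) ^ (j + 1) * Real.sqrt (m z κ ^ 2 + ℓ z κ ^ 2 + (Λ z κ / (L : ℝ) ^ (j + 1)) ^ 2)) ^ 2 := by
  have hL1 : 1 ≤ L := by omega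
  -- the direction `−X₀` at `U♭`: skew, periodic, same sup datum, same top (`U♭·e^{−X₀} = W`)
  have hnXs : IsSkewDir (fun y μ => -X₀ y μ) := fun y μ => (skewAdjoint (Matrix n n ℂ)).neg_mem (hX₀s y μ)
  have hnXP : IsPeriodicDir (fun y μ => -X₀ y μ) ((L ^ (j + 1) * N : ℕ) : ℤ) := fun y i μ => by
    show -X₀ (y + ((L ^ (j + 1) * N : ℕ) : ℤ) • e i) μ = -X₀ y μ
    rw [hX₀P y i μ]
  have hnX : ∀ (y : Site d) (μ : Fin d), ‖(fun y μ => -X₀ y μ) y μ‖ ≤ s₀ := fun y μ => by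
    show ‖-X₀ y μ‖ ≤ s₀
    rw [norm_neg]; exact hX₀ y μ
  have hfib' : cavgIter L (j + 1) (vary (vary W X₀ 1) (fun y μ => -X₀ y μ) 1) = cavgIter L (j + 1) (vary W X₀ 1) := by
    rw [vary_vary_neg, hfib]
  have hAx' : SmallField (vary (vary W X₀ 1) (fun y μ => -X₀ y μ) 1) x' := by rw [vary_vary_neg]; exact hWx'
  have h := norm_dirIter_le_combined_of_gaugedTwoTier_profile hd hL hUu hUP hx hsm hUx hA hK hnXs hnXP hs₀ hnX hσ₀ hfib' hx' hsm' hAx'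
    (gaugedTwoTier_far hG) hms hσsm hsm8 z κ
  rwa [norm_dirIter_neg hL1 j hUu hx hsj hUx X₀ z κ] at h

end

end Summit.QuantumFields.BalabanUV.T4Continuum.NE7GaugedTwoTierFar
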